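import Mathlib
import Summits.AtomisticToContinuum.Crystallization.Theses.ExcessDecayLiouville

/-!
# Sketch — crux HcpLiouville (stmt-AtomisticToContinuum-9332), crux-ideate round 1, ideator 2

First lemmas of the idea cards (statements only; they must elaborate, not be proved):

* `DisplacementForm` — the single-occupancy reduction every line uses (support, provable now).
* `TangentTubeStability η` — card `flat-at-infinity-blowdown`, K1 (the one non-perturbative input):
  PhononStability's inequality with the reference sites displaced by an ARBITRARY tube field
  `‖u‖∞ ≤ η` (the kit probe `tube_probe.py` measures its best constant `κ_tan(η)`).
* `LinearEnergyGrowth` — K2 (Caccioppoli for tube equilibria: the nn-strain energy in `B_R` grows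
  at most like `R`, i.e. mean-square strain `→ 0`).
* `FlatnessImprovement` — K3 (one-step improvement of flatness at LARGE scales only, `R ≥ R₀`,
  by blow-down compactness against linear hcp elasticity; `C/R⁴` = exterior-force floor).
* `SmallStrainLiouville` — K4 (the perturbative endgame: globally small nn-strain ⇒ trivial).
* `StationaryPairing` — card `ergodic-exactification`: finitary form of the stationary energy identity
  (box-averaged secant pairing of a tube equilibrium is a pure boundary term).
-/

namespace Summit.AtomisticToContinuum.Crystallization.Cruxes.HcpLiouville.IdeatorTwo

open scoped BigOperators
open Literature.MathematicalPhysics.StatisticalMechanics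

local notation "E3" => EuclideanSpace ℝ (Fin 3)

/-- The hexagonal period lattice `Λ` of the unit hcp stacking (verbatim from the route file). -/
def Lam : Set E3 :=
  {z | ∃ i j k : ℤ, z = (i : ℝ) • triangularVec₁ 1 + (j : ℝ) • triangularVec₂ 1 +
    (k : ℝ) • layerNormal (2 * Real.sqrt (2 / 3))}

/-- Admissible cell (route file). -/
def Adm (A : E3 →L[ℝ] E3) : Prop :=
  ∃ R : E3 ≃ₗᵢ[ℝ] E3, ‖A - (97 / 100 : ℝ) • (R.toContinuousLinearEquiv : E3 →L[ℝ] E3)‖ ≤ 1 / 40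

/-- hcp-like inner displacement (route file). -/
def Inner (t : Fin 2 → E3) (A : E3 →L[ℝ] E3) : Prop :=
  ‖t 1 - t 0 - A (barlowOffset 1 + layerNormal (Real.sqrt (2 / 3)))‖ ≤ 1 / 40

/-- Site set of the datum `(t, A)` (route file). -/
def Sites (t : Fin 2 → E3) (A : E3 →L[ℝ] E3) : Set E3 :=
  {p | ∃ m : Fin 2, ∃ z ∈ Lam, p = t m + A z}

/-- Two-way `ε`-matching on `B_r(c)` (route file). -/
def Near (X : Set E3) (c : E3) (r : ℝ) (t : Fin 2 → E3) (A : E3 →L[ℝ] E3) (ε : ℝ) : Prop :=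
  (∀ p ∈ X, dist p c ≤ r → ∃ m : Fin 2, ∃ z ∈ Lam, dist p (t m + A z) ≤ ε) ∧
  (∀ m : Fin 2, ∀ z ∈ Lam, dist (t m + A z) c ≤ r → ∃ p ∈ X, dist p (t m + A z) ≤ ε)

/-- `δ`-separation (route file). -/
def Sep (X : Set E3) (δ : ℝ) : Prop := ∀ p ∈ X, ∀ q ∈ X, p ≠ q → δ ≤ dist p q

/-- Lennard-Jones force balance at every point, `HasSum` form (route file). -/
def Equil (X : Set E3) : Prop :=
  ∀ p ∈ X, HasSum (fun q : {q : E3 // q ∈ X ∧ q ≠ p} =>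
    (deriv lennardJones (dist p q.1) / dist p q.1) • (p - q.1)) 0

/-- Bond Hessian `w ↦ wᵀ K(e) w` of the LJ pair term (route file). -/
noncomputable def Hess (e w : E3) : ℝ :=
  deriv (deriv lennardJones) ‖e‖ * (inner ℝ e w / ‖e‖) ^ 2 +
    deriv lennardJones ‖e‖ / ‖e‖ * (‖w‖ ^ 2 - (inner ℝ e w / ‖e‖) ^ 2)

/-- A TUBE EQUILIBRIUM over the datum `(t, A)`: a displacement field `u` of sup-norm `≤ 1/40` on the
sites whose displaced image is injective and in Lennard-Jones force balance. -/
def TubeEquilibrium (t : Fin 2 → E3) (A : E3 →L[ℝ] E3) (u : E3 → E3) : Prop :=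
  (∀ p ∈ Sites t A, ‖u p‖ ≤ 1 / 40) ∧ Set.InjOn (fun p => p + u p) (Sites t A) ∧
    Equil ((fun p => p + u p) '' Sites t A)

/-- SUPPORT (provable now): the single-occupancy / displacement form of the crux's hypothesis. Under
`δ`-separation, force balance and GLOBAL two-way `1/40`-matching, every site carries exactly one
particle within `1/40` — for every `δ > 0` (Disproof.lean near-miss `sep_of_equil_of_near`: exposed
particle of a maximal cluster; equivalently the virial identity of the finite cluster at one site,
`Σ_{p ∈ cluster} (p - c)·F_p = 0`, internal repulsive virial `≥ C(M,2)·4·10¹⁵` vs external `≤ 45 M²/40`)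
— so `X` is the displaced image of a tube field and δ is not load-bearing. -/
def DisplacementForm : Prop :=
  ∀ δ : ℝ, 0 < δ → ∀ X : Set E3, Sep X δ → Equil X →
    ∀ (t : Fin 2 → E3) (A : E3 →L[ℝ] E3), Adm A → Inner t A →
      (∀ (c : E3) (r : ℝ), Near X c r t A (1 / 40)) →
        ∃ u : E3 → E3, TubeEquilibrium t A u ∧ X = (fun p => p + u p) '' Sites t A

/-- CARD `flat-at-infinity-blowdown`, K1 = FIRST LEMMA: TANGENT TUBE STABILITY at radius `η`.
PhononStability's inequality, but with the Hessian evaluated at the sites DISPLACED by an arbitrary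
background field `u` of sup-norm `≤ η` (not assumed in equilibrium). The tube is convex, so this is
uniform harmonic stability of every configuration between the reference and any tube equilibrium; it is
the only non-perturbative input of the line (kit `tube_probe.py` measures the best `κ` as `κ_tan(η)`).
The line needs `η = 1/20` (= matching tolerance `1/40` + inner-shift slack of `Inner`). -/
def TangentTubeStability (η : ℝ) : Prop :=
  ∃ κ : ℝ, 0 < κ ∧ ∀ (t : Fin 2 → E3) (A : E3 →L[ℝ] E3), Adm A → Inner t A →
    ∀ u : E3 → E3, (∀ p ∈ Sites t A, ‖u p‖ ≤ η) →
      ∀ v : E3 → E3, (Function.support v).Finite → Function.support v ⊆ Sites t A →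
        κ * (∑' p : Sites t A, ∑' q : Sites t A,
              if dist (p : E3) q ≤ 11 / 10 then ‖v p - v q‖ ^ 2 else 0) ≤
          (∑' p : Sites t A, ∑' q : Sites t A,
              if (p : E3) ≠ q then Hess (((p : E3) + u p) - ((q : E3) + u q)) (v p - v q) else 0) / 2

/-- CARD `flat-at-infinity-blowdown`, K2: CACCIOPPOLI / LINEAR ENERGY GROWTH. For every tube
equilibrium the nearest-neighbour strain energy in a ball of radius `R` grows at most linearly in `R`
(reverse Poincaré against `sup |u| ≤ 1/40`; prestress removed by re-referencing to the relaxed inner shift,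
whose bond-force field is a null Lagrangian). Claimed: `TangentTubeStability (1/20) → LinearEnergyGrowth`. -/
def LinearEnergyGrowth : Prop :=
  ∃ C : ℝ, ∀ (t : Fin 2 → E3) (A : E3 →L[ℝ] E3), Adm A → Inner t A →
    ∀ u : E3 → E3, TubeEquilibrium t A u →
      ∀ (c : E3) (R : ℝ), 1 ≤ R →
        (∑' p : Sites t A, ∑' q : Sites t A,
          if dist (p : E3) c ≤ R ∧ dist (p : E3) q ≤ 11 / 10 then ‖u p - u q‖ ^ 2 else 0) ≤ C * R

/-- CARD `flat-at-infinity-blowdown`, K3: ONE-STEP IMPROVEMENT OF FLATNESS AT LARGE SCALES ONLY.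
There are `θ ∈ (0,1)`, `ε₁ > 0`, `R₀`, `C` such that for every tube equilibrium, every centre and every
`R ≥ R₀`: if on the sites of `B_R(c)` the field `u` is `λ`-close in mean square to a small-slope affine
field `p ↦ L (p - c) + b m` (`m` = sublattice) with `λ ≤ ε₁ R`, then on `B_{θR}(c)` it is
`(θ/2·λ + C/R⁴)`-close to a corrected affine field. (Blow-down compactness against linear hcp elasticity,
which is `C^{1,α}`; `C/R⁴` = the exterior-matter force floor of the `r⁻⁷` forces.) The hypothesis
`λ ≤ ε₁ R` is FREE for `R ≥ 1/(40 ε₁)` because `λ ≤ 1/40` always. -/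
def FlatnessImprovement : Prop :=
  ∃ θ ε₁ R₀ C : ℝ, 0 < θ ∧ θ < 1 ∧ 0 < ε₁ ∧ 0 < R₀ ∧
    ∀ (t : Fin 2 → E3) (A : E3 →L[ℝ] E3), Adm A → Inner t A →
      ∀ u : E3 → E3, TubeEquilibrium t A u →
        ∀ (c : E3) (R lam : ℝ), R₀ ≤ R → 0 ≤ lam → lam ≤ ε₁ * R →
          ∀ (L : E3 →L[ℝ] E3) (b : Fin 2 → E3), ‖L‖ ≤ ε₁ →
            (∑' z : Lam, ∑ m : Fin 2,
              if dist (t m + A z) c ≤ R then ‖u (t m + A z) - (L (t m + A z - c) + b m)‖ ^ 2 else 0)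
                ≤ lam ^ 2 * R ^ 3 →
            ∃ (L' : E3 →L[ℝ] E3) (b' : Fin 2 → E3), ‖L' - L‖ ≤ C * lam / R ∧
              (∑' z : Lam, ∑ m : Fin 2,
                if dist (t m + A z) c ≤ θ * R then ‖u (t m + A z) - (L' (t m + A z - c) + b' m)‖ ^ 2 else 0)
                  ≤ (θ / 2 * lam + C / R ^ 4) ^ 2 * (θ * R) ^ 3

/-- CARD `flat-at-infinity-blowdown`, K4: the PERTURBATIVE endgame. A tube equilibrium whose
nearest-neighbour strains are GLOBALLY below `s₀` is sublattice-wise constant (linearise at the relaxed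
two-lattice; `ℓ^∞` injectivity of the force-constant operator modulo sublattice translations by
Fourier/Bloch + PhononStability; contraction for the `O(|V‴| s₀)` remainder). -/
def SmallStrainLiouville : Prop :=
  ∃ s₀ : ℝ, 0 < s₀ ∧ ∀ (t : Fin 2 → E3) (A : E3 →L[ℝ] E3), Adm A → Inner t A →
    ∀ u : E3 → E3, TubeEquilibrium t A u →
      (∀ p ∈ Sites t A, ∀ q ∈ Sites t A, dist p q ≤ 11 / 10 → ‖u p - u q‖ ≤ s₀) →
        ∃ cst : Fin 2 → E3, ∀ (m : Fin 2) (z : E3), z ∈ Lam → u (t m + A z) = cst m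

/-- The four stubs compose to the crux's conclusion in displacement form: iterate K3 from arbitrarily
large scales down to `R₀` (excess is free-small up there), get `u` within `C R⁻⁴` of affine on every
`R`-ball for every `R ≥ R₀`, hence exactly affine, hence (bounded) sublattice-wise constant; or stop at the
scale where Caccioppoli (K2) turns mean-square smallness into POINTWISE small strain (discrete: sup ≤ ℓ²)
and finish with K4. This decl records the target shape. -/
def TubeLiouville : Prop :=
  ∀ (t : Fin 2 → E3) (A : E3 →L[ℝ] E3), Adm A → Inner t A →
    ∀ u : E3 → E3, TubeEquilibrium t A u →
      ∃ cst : Fin 2 → E3, ∀ (m : Fin 2) (z : E3), z ∈ Lam → u (t m + A z) = cst m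

/-- CARD `ergodic-exactification`, FIRST LEMMA (finitary form): the box-averaged SECANT PAIRING of a
tube equilibrium is a pure boundary term. With `g_pq := f((p+u p)-(q+u q)) - f(p-q)` (change of the bond
force relative to the reference two-lattice re-referenced to its relaxed inner shift `t⋆`) and
`w_pq := u p - u q`, force balance tested against `u - cst` on the sites of `B_R(c)` gives
`|Σ_{p,q ∈ B_R} g_pq · w_pq| ≤ C R²`: so the MEAN secant pairing vanishes, and under stationarity
(Krylov–Bogoliubov measures on the compact space of tube equilibria) it vanishes EXACTLY. -/
def StationaryPairing : Prop :=
  ∃ C : ℝ, ∀ (t : Fin 2 → E3) (A : E3 →L[ℝ] E3), Adm A → Inner t A →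
    Equil (Sites t A) →   -- the reference itself is relaxed (inner shift critical)
    ∀ u : E3 → E3, TubeEquilibrium t A u →
      ∀ (c : E3) (R : ℝ), 1 ≤ R →
        |∑' p : Sites t A, ∑' q : Sites t A,
          if dist (p : E3) c ≤ R ∧ dist (q : E3) c ≤ R ∧ (p : E3) ≠ q then
            inner ℝ ((deriv lennardJones ‖((p : E3) + u p) - ((q : E3) + u q)‖ /
                        ‖((p : E3) + u p) - ((q : E3) + u q)‖) • (((p : E3) + u p) - ((q : E3) + u q))
                      - (deriv lennardJones ‖(p : E3) - q‖ / ‖(p : E3) - q‖) • ((p : E3) - q))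
                    (u p - u q)
          else 0| ≤ C * R ^ 2


/-! ## Card `cell-determinant-convexification` (Friesecke–Theil / CDKM discrete null Lagrangian)

The hcp contact complex between an `A` layer (height `0`) and the `B` layer above it (height
`h = √(2/3)`, lateral offset `w = barlowOffset 1`) is tiled, per 2-D cell, by one UP tetrahedron
`{0, u₁, u₂, w + h e₃}`, one DOWN tetrahedron `{0, w + h e₃, w − u₁ + h e₃, w − u₂ + h e₃}` and one
octahedron `{u₁, u₂, u₁ + u₂, w + h e₃, w + u₁ + h e₃, w + u₂ + h e₃}` (edge `1` throughout); the
`B–A` gap carries their mirror images. Signed volumes of the deformed cells telescope (a DISCRETE NULL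
LAGRANGIAN), so adding `μ ·` (signed volume) to each cell energy changes no equilibrium and no
compactly supported energy difference, but it CAN make each cell energy convex along the tube
(it rewards the rotational directions that prestressed struts make concave, at the price of deviatoric
stiffness — CDKM's `W + μ det`). -/

/-- Signed volume (× 6) of the tetrahedron with vertices `p 0, p 1, p 2, p 3`:
`det [p1 − p0, p2 − p0, p3 − p0]`. A cubic polynomial in the coordinates. -/
noncomputable def signedVol6 (p : Fin 4 → E3) : ℝ :=
  Matrix.det (Matrix.of fun i j : Fin 3 => (p i.succ - p 0) j)

/-- The reference UP tetrahedron of the unit hcp stacking (edge 1): `0, u₁, u₂, w + √(2/3) e₃`. -/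
noncomputable def upTet : Fin 4 → E3 :=
  ![0, triangularVec₁ 1, triangularVec₂ 1, barlowOffset 1 + layerNormal (Real.sqrt (2 / 3))]

/-- The reference DOWN tetrahedron: `0, w + h e₃, w − u₁ + h e₃, w − u₂ + h e₃`. -/
noncomputable def downTet : Fin 4 → E3 :=
  ![0, barlowOffset 1 + layerNormal (Real.sqrt (2 / 3)),
      barlowOffset 1 - triangularVec₁ 1 + layerNormal (Real.sqrt (2 / 3)),
      barlowOffset 1 - triangularVec₂ 1 + layerNormal (Real.sqrt (2 / 3))]

/-- The reference octahedron over the `C` hole `2w + (h/2) e₃`: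
`u₁, u₂, u₁ + u₂` (layer `A`) and `w + h e₃, w + u₁ + h e₃, w + u₂ + h e₃` (layer `B`). -/
noncomputable def octa : Fin 6 → E3 :=
  ![triangularVec₁ 1, triangularVec₂ 1, triangularVec₁ 1 + triangularVec₂ 1,
    barlowOffset 1 + layerNormal (Real.sqrt (2 / 3)),
    barlowOffset 1 + triangularVec₁ 1 + layerNormal (Real.sqrt (2 / 3)),
    barlowOffset 1 + triangularVec₂ 1 + layerNormal (Real.sqrt (2 / 3))]

/-- Signed volume (× 6) of the octahedron `q`, triangulated into four tetrahedra around the diagonal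
`q 0 — q 5` (vertices `0,5` are opposite: `u₁` and `w + u₂ + h e₃`). -/
noncomputable def octaVol6 (q : Fin 6 → E3) : ℝ :=
  signedVol6 ![q 0, q 1, q 3, q 5] + signedVol6 ![q 0, q 3, q 4, q 5] +
    signedVol6 ![q 0, q 4, q 2, q 5] + signedVol6 ![q 0, q 2, q 1, q 5]

/-- LJ edge energy of a cell with vertex map `x` over an edge list, each edge weighted by `1/4`
(in the tetrahedral–octahedral honeycomb every edge is shared by two tetrahedra and two octahedra). -/
noncomputable def cellEdgeEnergy {n : ℕ} (edges : List (Fin n × Fin n)) (x : Fin n → E3) : ℝ :=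
  (edges.map fun e => lennardJones (dist (x e.1) (x e.2)) / 4).sum

/-- All 6 edges of a tetrahedron. -/
def tetEdges : List (Fin 4 × Fin 4) := [(0,1), (0,2), (0,3), (1,2), (1,3), (2,3)]

/-- The 12 edges of the octahedron `octa` (all vertex pairs at reference distance 1; the three
diagonals `(0,5), (1,4), (2,3)` have length `√2` and are NOT edges). -/
def octEdges : List (Fin 6 × Fin 6) :=
  [(0,1), (0,2), (0,3), (0,4), (1,2), (1,3), (1,5), (2,4), (2,5), (3,4), (3,5), (4,5)]

/-- CARD `cell-determinant-convexification`, FIRST LEMMA (tetrahedral half; the octahedral half is the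
same statement with `octa/octEdges/octaVol6`): there are a volume multiplier `μ` and a tube radius
`η ≥ 1/40` such that for every admissible cell `A`, the UP- and DOWN-cell energies corrected by
`μ ·` signed volume are CONVEX functions of the four vertex positions on the product of `η`-balls
around the reference vertices `A (upTet i)` (resp. `A (downTet i)`). Far bonds (second shell and
beyond, longitudinally concave, total weight ≈ 5 % of the first shell's stiffness) are to be
distributed along chains of cells in the full statement; this decl is the load-bearing core and the
object of the cheapest falsifier (an eigenvalue/SDP scan at the reference, then interval arithmetic
over the 12-dimensional vertex box). -/
def TetraCellConvexity : Prop :=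
  ∃ μ η : ℝ, 1 / 40 ≤ η ∧ ∀ A : E3 →L[ℝ] E3, Adm A →
    ∀ ref ∈ ({upTet, downTet} : Set (Fin 4 → E3)),
      ConvexOn ℝ {x : Fin 4 → E3 | ∀ i, dist (x i) (A (ref i)) ≤ η}
        (fun x => cellEdgeEnergy tetEdges x + μ * signedVol6 x)

/-- Octahedral half of the first lemma. -/
def OctaCellConvexity : Prop :=
  ∃ μ η : ℝ, 1 / 40 ≤ η ∧ ∀ A : E3 →L[ℝ] E3, Adm A →
    ConvexOn ℝ {x : Fin 6 → E3 | ∀ i, dist (x i) (A (octa i)) ≤ η}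
      (fun x => cellEdgeEnergy octEdges x + μ * octaVol6 x)

/-- The structural fact behind the lever, in its simplest finite form: the signed volume is AFFINE in
each vertex separately (a determinant is linear in each row), hence its second differences in any
single vertex vanish — the pointwise identity from which "Σ over cells of signed volumes is a null
Lagrangian" (telescoping over the closed star of a vertex) follows. Provable now (multilinearity of
`Matrix.det`). -/
def SignedVolAffineInVertex : Prop :=
  ∀ (p : Fin 4 → E3) (i : Fin 4) (d : E3) (s : ℝ),
    signedVol6 (Function.update p i (p i + s • d)) =
      (1 - s) * signedVol6 p + s * signedVol6 (Function.update p i (p i + d))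


/-! ## Sharpening after the kit probe (j008231, 2026-08-16)

The probe separates two tube constants: the TANGENT constant `κ_tan(η)` (PhononStability at displaced
sites, `TangentTubeStability`) is positive at `η = 1/40` in every window case (0.14–0.38) but NEGATIVE at
`η = 1/20` (−0.15 … −0.40), threshold `η⋆_tan ≈ 0.034–0.038` — knife-edge at the needed `1/40 + ρ`
(`ρ ≤ 0.0104`); the SECANT self-form constant `R_sec(η)` — what the Caccioppoli test `φ = η²(u − c)`
literally consumes — stays positive in every case up to `η = 3/40` (≥ 0.11; ≥ 0.21 at `1/20`; ≥ 0.34 at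
`1/40`). So K1 of card `flat-at-infinity-blowdown` is re-cut as the weaker statement below. -/

/-- CARD `flat-at-infinity-blowdown`, K1 SHARPENED: SECANT TUBE MONOTONICITY at radius `η`. For every
admissible datum whose reference two-lattice is itself in force balance (relaxed inner shift) and every
finitely supported tube field `u` (`‖u‖∞ ≤ η`), the secant self-pairing
`½ ΣΣ (f((p+u p)−(q+u q)) − f(p−q)) · (u p − u q)` (with `f(e) = V′(|e|) e/|e|`, the LJ bond force)
dominates `κ₁ ΣΣ_nn ‖u p − u q‖²`. Each bond's term depends only on its own relative displacement, it
equals `∫₀¹ (u p − u q)ᵀ K(p − q + θ(u p − u q)) (u p − u q) dθ`, so `TangentTubeStability η` implies it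
(the tube is convex), not conversely; the kit's `R_sec(η)` is its best constant over supercell-periodic
fields (relaxed cell: 0.63 / 0.52 / 0.32 / 0.18 at η = 1/80, 1/40, 1/20, 3/40). This — not tangent
stability — is the inequality the Caccioppoli step K2 uses. -/
def SecantTubeMonotonicity (η : ℝ) : Prop :=
  ∃ κ₁ : ℝ, 0 < κ₁ ∧ ∀ (t : Fin 2 → E3) (A : E3 →L[ℝ] E3), Adm A → Inner t A → Equil (Sites t A) →
    ∀ u : E3 → E3, (Function.support u).Finite → Function.support u ⊆ Sites t A →
      (∀ p ∈ Sites t A, ‖u p‖ ≤ η) →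
        κ₁ * (∑' p : Sites t A, ∑' q : Sites t A,
              if dist (p : E3) q ≤ 11 / 10 then ‖u p - u q‖ ^ 2 else 0) ≤
          (∑' p : Sites t A, ∑' q : Sites t A,
              if (p : E3) ≠ q then
                inner ℝ ((deriv lennardJones ‖((p : E3) + u p) - ((q : E3) + u q)‖ /
                            ‖((p : E3) + u p) - ((q : E3) + u q)‖) • (((p : E3) + u p) - ((q : E3) + u q))
                          - (deriv lennardJones ‖(p : E3) - q‖ / ‖(p : E3) - q‖) • ((p : E3) - q))
                        (u p - u q)
              else 0) / 2

/-- The tube is convex, so tangent stability along it implies secant monotonicity (average the tangent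
inequality over `θ ∈ [0,1]` at backgrounds `θ u`, test field `u`). Recorded as the intended first proof
obligation relating the two cuts of K1. -/
def TangentImpliesSecant : Prop := ∀ η : ℝ, 0 ≤ η → TangentTubeStability η → SecantTubeMonotonicity η

end Summit.AtomisticToContinuum.Crystallization.Cruxes.HcpLiouville.IdeatorTwo
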